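import Summits.QuantumAdvantage.QuantumAdvantage.Theorems.ResponseDialH

/-! # ResponseDialI — ResponseDial REV 1 delta part 6/6 (mechanical split for landing; content verbatim; scopes re-opened with their variables) -/

set_option linter.dupNamespace false
noncomputable section
open scoped Classical

namespace Summit.QuantumAdvantage.QuantumAdvantage.Theorems.ResponseDial
open Finset
open Literature.Computability.QuantumComplexity Literature.Computability.QuantumComplexity.RingHLF
open Literature.Computability.MetaComplexity Literature.Computability.MetaComplexity.Smolensky
open Summit.QuantumAdvantage.AdviceFreeQNC0
open Summit.QuantumAdvantage.QuantumAdvantage.Theorems.AnchorDial (outB dev cN orbF orbL orbL_cons fz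
  cN_orbF_cast oddZeros_orbF win_iff gCond_iff_cN card_filter_orbF orbF_false flip2 card_odd_ge loss_shape_mono)
open Summit.QuantumAdvantage.QuantumAdvantage.Theorems.AnchorDial.Core (ct sg)
open Summit.QuantumAdvantage.QuantumAdvantage.Theorems.HolonomyDial (gCond tPoly tPoly_apply tPoly_mem card_odd_le
  xorP xorP_mem xorP_apply_bool mono_singleton_apply indP indP_mem indP_apply)
open Summit.QuantumAdvantage.QuantumAdvantage.Theorems.StabilizerDial (apIdx apStrat apStrat_mem bitP bitP_apStrat
  pad rel_pad_iff outB_pad_zero pad_mem StabFew rowMask bitP_pad mem_dev_pad_apStrat_iff BlockRec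
  blockSelect_of_fewLocus goodBound_of_blockRec fibreIdentityAt_of_block oddSliceBound_holds eventually_polylog
  side_bounds)
open Summit.QuantumAdvantage.QuantumAdvantage.Theorems.LocusDial (Coverable FewLocus)
open Summit.QuantumAdvantage.QuantumAdvantage.Theorems.SparsityDial (real_loss_of_frac AntipodalLoss3 stabFew_mono_mr
  one_le_logpow)
open Summit.QuantumAdvantage.QuantumAdvantage.Theses.SparsityDial (DenseGenericLoss3)

/-! ## §13  THE METHOD AS A THEOREM: orbit certificates (the TYPE-SPAN criterion) and placement MENUS.
Every law above is an instance of one statement: if an odd set `Λ` of orbit points meets EVERY position's column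
«deviates at the point ∧ phase admissible at the point» evenly, the strategy loses somewhere on the orbit
(`orbitCert_loses`) — i.e. a certificate exists iff the all-ones vector is outside the `𝔽₂`-span of the realised
columns.  The laws differ only in how finitely many response TYPES make the column condition `decide`-able.  And the
placement may depend on the input: with a MENU `B` of placements, `#S ≤ 32 · #B · #{odd losers}` for any set `S` of odd
inputs each certified under some placement of the menu (`menu_loss_count`) — a polynomial menu still gives a polynomial
loss.  The residual of D after this file is therefore: cheaply-dense low-degree strategies for which, for all but a
`n^{-ω(1)}` fraction of odd inputs, EVERY placement of five separated pairs has the all-ones vector inside its column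
span (RESPONSE-RICH strategies). -/

section Master
variable {N : ℕ}

/-- the column of position `k` at orbit point `j` for placement `b`: «deviates ∧ phase admissible». -/
def col (b : Fin 5 → ℕ) (P : Fin N → CubeFn (ZMod 3) N) (x : Fin N → Bool) (k : Fin N) (j : ℕ) : Bool :=
  decide (k ∈ dev P (orbF b (εOf j) x)) &&
    decide (((cN x k.val : ℕ) : ZMod 3) + sF (fun i => zpar x (b i + 1)) (εOf j)
      ((univ.filter fun i : Fin 5 => b i + 1 ≤ k.val).card) ≠ 2)

/-- an ORBIT CERTIFICATE for `(P, b, x)`: an odd list of orbit points meeting every position's column evenly. -/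
def OrbitCert (b : Fin 5 → ℕ) (P : Fin N → CubeFn (ZMod 3) N) (x : Fin N → Bool) (Λ : List ℕ) : Prop :=
  Λ.length % 2 = 1 ∧ ∀ k : Fin N, (Λ.countP (col b P x k)) % 2 = 0

/-- **MASTER LEMMA (type-span criterion)**: an orbit certificate forces a loss on the orbit — for EVERY strategy. -/
theorem orbitCert_loses {b : Fin 5 → ℕ} (hb : ∀ i j : Fin 5, i < j → b i + 2 ≤ b j) (hbN : ∀ i, b i + 3 ≤ N)
    (hN : 3 ≤ N) (P : Fin N → CubeFn (ZMod 3) N) (x : Fin N → Bool) (hx : OddZeros x) (Λ : List ℕ)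
    (hΛ : OrbitCert b P x Λ) : ∃ ε : Fin 5 → Bool, ¬ Rel (orbF b ε x) (outB P (orbF b ε x)) := by
  obtain ⟨hodd, hcol⟩ := hΛ
  by_contra hall
  push Not at hall
  have hW : ∀ j : ℕ, (∑ k : Fin N, (if col b P x k j = true then (1 : ZMod 2) else 0)) = 1 := by
    intro j
    have ho : OddZeros (orbF b (εOf j) x) := (oddZeros_orbF hbN (εOf j) x).2 hx
    have hwin := (win_iff hN P _ ho).1 (hall (εOf j))
    have hphase : ∀ k : Fin N, gCond (orbF b (εOf j) x) k.val ↔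
        ((cN x k.val : ℕ) : ZMod 3) + sF (fun i => zpar x (b i + 1)) (εOf j)
          ((univ.filter fun i : Fin 5 => b i + 1 ≤ k.val).card) ≠ 2 := by
      intro k
      rw [gCond_iff_cN, mod3_ne_two, cN_orbF_cast x hb hbN (εOf j) k.val (le_of_lt k.isLt), shift_eq hb]
    have hfilt : ((dev P (orbF b (εOf j) x)).filter fun k => gCond (orbF b (εOf j) x) k.val) =
        univ.filter fun k => col b P x k j = true := by
      ext k
      rw [mem_filter, mem_filter, hphase k]
      unfold col
      simp only [mem_univ, true_and, Bool.and_eq_true, decide_eq_true_eq]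
    rw [hfilt] at hwin
    have h1 := castZ2_of_mod_eq_one hwin
    rw [natCast_card_filter] at h1
    exact h1
  have hL : (Λ.map fun j => ∑ k : Fin N, (if col b P x k j = true then (1 : ZMod 2) else 0)).sum =
      (Λ.map fun _ => (1 : ZMod 2)).sum := by
    congr 1; exact List.map_congr_left fun j _ => hW j
  have hR : (Λ.map fun _ => (1 : ZMod 2)).sum = 1 := by
    rw [List.map_const', List.sum_replicate, nsmul_eq_mul, mul_one]; exact castZ2_of_mod_eq_one hodd
  rw [hR, list_sum_swap] at hL
  have h0 : ∑ k : Fin N, (Λ.map fun j => if col b P x k j = true then (1 : ZMod 2) else 0).sum = 0 :=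
    sum_eq_zero fun k _ => by rw [list_sum_ite]; exact castZ2_of_mod_eq_zero (hcol k)
  rw [h0] at hL
  exact zero_ne_one hL

/-- **MASTER COUNT with a placement MENU**: inputs certified under SOME placement of the menu are charged to odd
losers, `32 · #B` to one — the placement may depend on the input. -/
theorem menu_loss_count (hN : 3 ≤ N) (B : Finset (Fin 5 → ℕ))
    (hB : ∀ b ∈ B, (∀ i j : Fin 5, i < j → b i + 2 ≤ b j) ∧ ∀ i, b i + 3 ≤ N)
    (P : Fin N → CubeFn (ZMod 3) N) (S : Finset (Fin N → Bool))
    (hS : ∀ x ∈ S, OddZeros x ∧ ∃ b ∈ B, ∃ Λ : List ℕ, OrbitCert b P x Λ) :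
    S.card ≤ 32 * B.card * (univ.filter fun x : Fin N → Bool => OddZeros x ∧ ¬ Rel x (outB P x)).card := by
  calc S.card ≤ (B.biUnion fun b => univ.filter fun x : Fin N → Bool => ∃ ε : Fin 5 → Bool,
          (OddZeros (orbF b ε x) ∧ ¬ Rel (orbF b ε x) (outB P (orbF b ε x)))).card := by
        refine card_le_card fun x hx => ?_
        obtain ⟨hodd, b, hb, Λ, hΛ⟩ := hS x hx
        rw [mem_biUnion]
        refine ⟨b, hb, mem_filter.2 ⟨mem_univ _, ?_⟩⟩
        obtain ⟨ε, hε⟩ := orbitCert_loses (hB b hb).1 (hB b hb).2 hN P x hodd Λ hΛ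
        exact ⟨ε, (oddZeros_orbF (hB b hb).2 ε x).2 hodd, hε⟩
    _ ≤ ∑ b ∈ B, (univ.filter fun x : Fin N → Bool => ∃ ε : Fin 5 → Bool,
          (OddZeros (orbF b ε x) ∧ ¬ Rel (orbF b ε x) (outB P (orbF b ε x)))).card := card_biUnion_le
    _ ≤ ∑ b ∈ B, 32 * (univ.filter fun x : Fin N → Bool => OddZeros x ∧ ¬ Rel x (outB P x)).card :=
        sum_le_sum fun b _ => card_exists_orbF_le b (fun y => OddZeros y ∧ ¬ Rel y (outB P y))
    _ = 32 * B.card * (univ.filter fun x : Fin N → Bool => OddZeros x ∧ ¬ Rel x (outB P x)).card := by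
        rw [sum_const, smul_eq_mul]; ring

end Master



end Summit.QuantumAdvantage.QuantumAdvantage.Theorems.ResponseDial
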